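import Literature.MathematicalPhysics.QuantumManyBody.PeriodicBoseGasMomentumSector
import Literature.MathematicalPhysics.QuantumManyBody.WeightedCorrector
import Literature.MathematicalPhysics.QuantumManyBody.BoseGasStructureFactor
import Mathlib.Analysis.Calculus.FDeriv.Prod
import HarnessLib

/-!
# The ground-state Dirichlet form on the `N`-particle torus and its sectorial Poincaré constants

Topic `Literature/MathematicalPhysics/QuantumManyBody` (definition item
`defn-GroundStateDirichletForm`, wanted by route `BECSectorPoincareTwoScale` of
`AtomisticToContinuum/BoseEinsteinCondensation`, item stmt-AtomisticToContinuum-9092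
`TwoScaleReduction`, and by the cards `sector-gap-no-cheap-momentum` (N4),
`parent-hamiltonian-anchor`). Companion of `PeriodicBoseGas.lean` (`cellN`, `kineticDensity`,
`PeriodicTrialState`, `periodicEnergy`), `PeriodicBoseGasMomentumSector.lean` (`HasTotalMomentum`,
`momentumSectorEnergy`, `planeWaveSum`) and `WeightedCorrector.lean` (`dirichletFormW`, the real
bilinear form of a real weight).

**The ground-state transform** [Davies1989, §4.2 "Transference to weighted `L²` spaces",
Thm. 4.2.1 and its proof, pp. 109–110]. For `H = -∇·a∇ + V` and a positive `C²` function `φ`, the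
substitution `f = φ g` gives
`Q(φ g) = ∫ {∑ aᵢⱼ ∂ᵢg ∂ⱼḡ + (V - X)|g|²} φ² dx`, `X = φ⁻¹ ∇·(a∇φ)`, and `U_φ g = φ g` is unitary
from `L²(φ² dx)` onto `L²(dx)`; when `φ = φ₀ > 0` is the ground state, `Hφ₀ = E₀φ₀`, one has
`V - X = E₀` and `H̃ = U⁻¹(H - E₀)U` is the operator of the **Dirichlet form**
`g ↦ ∫ |∇g|² φ₀² dx` on `L²(φ₀² dx)` ("the idea … goes back to Nelson (1966) and Gross (1976)",
ibid., notes to §4.2; the energy forms `∫ |∇f|² φ² dx` are the subject of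
[AlbeverioHoeghkrohnStreit1977]). For `N` bosons on the torus `(ℝ³/Lℤ³)^N`
(`H = ∑ⱼ -Δⱼ + ∑_{i<j} v^per(xᵢ - xⱼ)`, units `ħ = 2m = 1`) and the positive, periodic,
Bose-symmetric, translation-invariant ground state `Ψ₀`, the map `F ↦ FΨ₀` identifies

* the Bose-symmetric periodic form domain of `H - E₀` with the periodic symmetric functions `F`
  in `L²(|Ψ₀|² dX)`, `⟨FΨ₀, (H - E₀) FΨ₀⟩ = E_{Ψ₀}(F) := ∫_{cell} ∑ᵢ |∇ᵢF|² |Ψ₀|² dX`,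
  `‖FΨ₀‖² = ‖F‖²_{Ψ₀} := ∫_{cell} |F|² |Ψ₀|² dX`;
* the sector of total momentum `k` (`HasTotalMomentum k`, the Bloch condition
  `Ψ(x₁ + s, …, x_N + s) = e^{ik·s} Ψ(X)`) with the **Bloch-`k` test functions**
  `F(X + s𝟙) = e^{ik·s} F(X)` (momenta add under products and `Ψ₀` has momentum `0`);
* hence the infimum of the excitation spectrum in the sector,
  `ε^{L,N}(k) = inf sp (H(k) - E^{L,N})` [CorneanDerezinskiZin2009, §1.1 (1.6)], with the
  **sectorial Poincaré constant** `ω_{Ψ₀}(k) = inf {E_{Ψ₀}(F) / ‖F‖²_{Ψ₀} : F Bloch-k, F ≠ 0}` of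
  the probability measure `|Ψ₀|² dX`.

Feynman's ansatz `F = ρ_k = ∑ⱼ e^{ik·xⱼ}` (the Bijl–Feynman state `ρ_k|0⟩`, [Stringari1995, §3
(37), (40)]; [Feynman1954]) has `E_{Ψ₀}(ρ_k) = N|k|²` (the f-sum rule) and
`‖ρ_k‖²_{Ψ₀} = N S(k)`, whence the famous upper bound `ω(k) ≤ |k|²/S(k)` (`= k²/2mS(k)`).

## Main definitions (namespace `Literature.MathematicalPhysics.QuantumManyBody.BoseGas`)

No ground-state object is needed or constructed: everything below is defined for an arbitrary
*weight* `Ψ : (ℝ³)^N → ℂ` (entering only through the Born density `|Ψ|²` on the cell) and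
arbitrary test functions, as `ℝ≥0∞`-valued lower Lebesgue integrals over the fundamental cell
`cellN N L = [0,L)^{3N}`, exactly like `periodicEnergy`.

* `groundStateDirichletForm L Ψ F = E_Ψ(F) = ∫⁻_{cellN N L} kineticDensity F X · ‖Ψ X‖₊² =
  ∫_{cell} ∑ᵢ ∑ₐ |∂_{x_{i,a}} F(X)|² |Ψ(X)|² dX`.
* `weightedNormSq L Ψ F = ‖F‖²_Ψ = ∫⁻_{cellN N L} ‖F X‖₊² ‖Ψ X‖₊²` (`= ∫_{cell} |FΨ|²`,
  `weightedNormSq_eq`: unitarity of `U_Ψ`).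
* `IsBlochTest L k F` — the Bloch-`k` test class: `F` is `C¹`, `Lℤ³`-periodic in every particle,
  Bose-symmetric, and `HasTotalMomentum k F`.
* `sectorPoincareConstant L Ψ k = ω_Ψ(k) = ⨅ {E_Ψ(F) / ‖F‖²_Ψ : IsBlochTest L k F,
  0 < ‖F‖²_Ψ < ∞}`.
* `PeriodicTrialState.gsTransform Ψ hF … = FΨ/‖FΨ‖` — the ground-state transform `U_Ψ` at the
  level of admissible periodic states (Davies' `U_φ f = φ f`), landing in the sector `k` when `Ψ`
  has total momentum `0` (`hasTotalMomentum_gsTransform`, `momentumSectorEnergy_le_gsTransform`).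

## API (all proved)

* unfolding (`groundStateDirichletForm_eq`, `weightedNormSq_eq`), constants are `E_Ψ`-null
  (`groundStateDirichletForm_const`), quadratic scaling in `F` and scale invariance of the
  Rayleigh quotient (`…_const_mul`, `groundStateDirichletForm_div_weightedNormSq_const_mul`),
  constant weights (`groundStateDirichletForm_const_weight`), conjugation
  (`groundStateDirichletForm_conj`), finiteness for continuous data (`weightedNormSq_ne_top`,
  `groundStateDirichletForm_ne_top`), and agreement with the real bilinear form of
  `WeightedCorrector.lean` on real data (`groundStateDirichletForm_ofReal`:
  `E_w(φ) = ENNReal.ofReal (dirichletFormW L w φ φ)`);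
* the Bloch class: constants (`k = 0`), products (momenta add), sums, scalar multiples, complex
  conjugates (`k ↦ -k`), Feynman's density waves `planeWaveSum L n = ρ_{2πn/L}`
  (`isBlochTest_planeWaveSum`; `planeWaveSum_eq_densityWave` bridges to
  `BoseGasStructureFactor.densityWave`), and the dual-lattice constraint
  `F ≢ 0 ⇒ k ∈ (2π/L)ℤ³` (`IsBlochTest.exists_eq_latticeVec`);
* the Poincaré constant: the variational principle `sectorPoincareConstant_le`, the criterion
  `le_sectorPoincareConstant_iff` (`λ ≤ ω_Ψ(k) ⟺ λ‖F‖²_Ψ ≤ E_Ψ(F)` on the class), the Poincaré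
  inequality `sectorPoincareConstant_mul_weightedNormSq_le`, `ω_Ψ(0) = 0`
  (`sectorPoincareConstant_zero`, test function `1`), `ω_Ψ(-k) = ω_Ψ(k)`
  (`sectorPoincareConstant_neg`), `ω_Ψ(k) = ⊤` off the dual lattice
  (`sectorPoincareConstant_eq_top_of_forall_ne`), the centre-of-mass lower bound
  `|k|²/N ≤ ω_Ψ(k)` for *every* weight (`ofReal_norm_sq_div_le_sectorPoincareConstant`, from
  `HasTotalMomentum.norm_sq_mul_le_kineticDensity`), the f-sum-rule numerator
  `E_Ψ(ρ_k) = N|k|² ∫_{cell}|Ψ|²` (`groundStateDirichletForm_planeWaveSum`, via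
  `kineticDensity_planeWaveSum`) and Feynman's upper bound
  `ω_Ψ(k) ≤ N|k|² ∫|Ψ|² / ‖ρ_k‖²_Ψ` (`sectorPoincareConstant_latticeVec_le`); both bounds meet for
  one free particle: `ω(k) = |k|²` exactly (`sectorPoincareConstant_const_one`, non-vacuity).

## Design choices

* **Weights are unbundled functions**, not `PeriodicTrialState`s: the requesters need
  `Ψ = Ψ₀.ψ` (a normalised periodic state) as well as unnormalised Jastrow weights
  `∏ f(xᵢ - xⱼ)` (parent Hamiltonians, card N4); all three objects are homogeneous of degree two
  in `Ψ` and the Rayleigh quotient is scale free. `N` is read off `Ψ`, `L` is explicit.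
* **Complex test functions, quadratic form, `ℝ≥0∞`.** Bloch functions with `k ≠ 0` are complex,
  so the real bilinear `dirichletFormW` of `WeightedCorrector.lean` cannot serve; the diagonal of
  the two agree on real data (`groundStateDirichletForm_ofReal`). The integrand
  `kineticDensity F X * ‖Ψ X‖₊²` is literally that of `periodicEnergy` with the interaction
  replaced by the weight, so provers can move between `⟨FΨ, H FΨ⟩` and `E_Ψ(F)` termwise.
* **The test class is periodic in each particle.** The Bloch condition constrains only the
  simultaneous translation; per-particle `Lℤ³`-periodicity of `F` is what makes `FΨ₀` a state on
  the torus (e.g. `e^{iq·(x₁-x₂)}` has momentum `0` but is a torus function only for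
  `q ∈ (2π/L)ℤ³`). With it, `F ≢ 0` forces `k ∈ (2π/L)ℤ³`, as for `momentumSectorEnergy`.
* **Junk-free quotient.** The infimum ranges over `0 < ‖F‖²_Ψ < ∞`, so `E/‖F‖²` never takes
  the `ℝ≥0∞` junk values `x/0`, `x/⊤`; for continuous `Ψ` the finiteness side condition is
  automatic (`weightedNormSq_ne_top`). Over an empty class (off the dual lattice, or `L ≤ 0 < N`)
  the constant is `⊤`, matching `momentumSectorEnergy`.
* **Deliberately not here**: the identity `⟨FΨ₀, (H - E₀)FΨ₀⟩ = E_{Ψ₀}(F)` itself and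
  `ω_{Ψ₀}(k) = ε^{L,N}(k)` — they need a ground-state *object* (existence, positivity,
  regularity of `Ψ₀`, one integration by parts on the torus) and are route business (thesis of
  `BECSectorPoincareTwoScale`: "provers of rank 2 do it inline"); the centring of `S(k)`
  (`‖ρ_k‖²_Ψ` here is the uncentred `N S(k)`; for translation-invariant `Ψ` and `k ≠ 0` the mean
  of `ρ_k` vanishes); block coarse-grainings and conditional laws (the route's D2–D3). No named
  facts are introduced.
* Mathlib has neither Dirichlet forms nor Bloch functions nor Poincaré constants of a measure
  (searched `DirichletForm`, `Bloch`, `poincareConstant`, `spectralGap`); `fderiv`, `lintegral`,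
  `ContDiff`, `EuclideanSpace` are Mathlib's.

## References

* [Davies1989] E. B. Davies, *Heat Kernels and Spectral Theory*, Cambridge Tracts in Math. 92,
  CUP 1989: §4.2 (pp. 109–112), Thm. 4.2.1 and its proof, Lemma 4.2.2, the unitary
  `U : L²(Ω, φ₀² dx) → L²(Ω, dx)` and `H̃ = U⁻¹(H - E₀)U` (after Thm. 4.2.3), notes to §4.2
  (Nelson 1966, Gross 1976).
* [AlbeverioHoeghkrohnStreit1977] S. Albeverio, R. Høegh-Krohn, L. Streit, *Energy forms,
  Hamiltonians, and distorted Brownian paths*, J. Math. Phys. 18 (1977) 907–917 (the energy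
  forms `∫ |∇f|² φ² dx`; cited after the requester, not consulted here).
* [CorneanDerezinskiZin2009] H. D. Cornean, J. Dereziński, P. Ziń, J. Math. Phys. 50 (2009)
  062103: §1.1 (1.6) (`H^{L,n}(k)`, `ε^{L,n}(k)`).
* [Stringari1995] S. Stringari, *Sum rules and Bose–Einstein condensation*, in: Bose–Einstein
  Condensation (Griffin, Snoke, Stringari eds.), CUP 1995: §2.3 (16) (Feynman bound), §3 (37)
  (`|F⟩ = ρ_q|0⟩/√(NS(q))`), (40) (`ε_F(q) = ⟨F|H|F⟩/⟨F|F⟩ = q²/2mS(q)`).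
* [Feynman1954] R. P. Feynman, Phys. Rev. 94 (1954) 262–277.
-/

noncomputable section

open MeasureTheory Filter WithLp
open scoped ENNReal NNReal ComplexConjugate

namespace Literature.MathematicalPhysics.QuantumManyBody.BoseGas

variable {N : ℕ} {L : ℝ}

/-! ### The form, the weighted norm, the Bloch class, the Poincaré constant -/

/-- **The ground-state (Dirichlet) form** `E_Ψ(F) = ∫_{[0,L)^{3N}} ∑ᵢ ∑ₐ |∂_{x_{i,a}} F(X)|² |Ψ(X)|² dX
∈ [0, ∞]` of the weight `Ψ` on the `N`-particle torus of side `L`, evaluated at the test function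
`F`: the quadratic form of `U_Ψ⁻¹ (H - E₀) U_Ψ`, `U_Ψ F = FΨ`, when `Ψ > 0` is the ground state of
`H = ∑ⱼ -Δⱼ + (potential)` with energy `E₀` (units `ħ = 2m = 1`), i.e. the Dirichlet form of the
`|Ψ|² dX`-symmetric diffusion. The integrand is `kineticDensity F X * ‖Ψ X‖₊²` on the fundamental
cell, as in `periodicEnergy`. [cite: Davies1989, §4.2 Thm. 4.2.1 (proof), pp. 109–110] -/
def groundStateDirichletForm (L : ℝ) (Ψ F : Config N → ℂ) : ℝ≥0∞ :=
  ∫⁻ X in cellN N L, kineticDensity F X * (‖Ψ X‖₊ : ℝ≥0∞) ^ 2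

/-- **The weighted norm** `‖F‖²_Ψ = ∫_{[0,L)^{3N}} |F(X)|² |Ψ(X)|² dX ∈ [0, ∞]`, the squared norm of
`F` in `L²(cell, |Ψ|² dX)`, equal to `‖FΨ‖²_{L²(cell)}` (`weightedNormSq_eq`): the unitary
`U_Ψ F = FΨ` of the ground-state transform. [cite: Davies1989, §4.2 Thm. 4.2.1 (proof), pp. 109–110] -/
def weightedNormSq (L : ℝ) (Ψ F : Config N → ℂ) : ℝ≥0∞ :=
  ∫⁻ X in cellN N L, (‖F X‖₊ : ℝ≥0∞) ^ 2 * (‖Ψ X‖₊ : ℝ≥0∞) ^ 2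

/-- **The Bloch-`k` test class** on the `N`-particle torus of side `L`: `F : (ℝ³)^N → ℂ` of class
`C¹`, `Lℤ³`-periodic in every particle (on the generators `L e_{i,a}`, as `PeriodicTrialState`),
Bose-symmetric, and transforming under the simultaneous translation of all particles by the
character `e^{ik·s}`: `F(x₁ + s, …, x_N + s) = e^{ik·s} F(X)` (`HasTotalMomentum k F`). For a
positive, periodic, symmetric, translation-invariant `Ψ₀` these are exactly the `F` with `FΨ₀` in
the Bose-symmetric periodic `C¹` form core of total momentum `k`.
[cite: CorneanDerezinskiZin2009, §1.1 (1.6)] -/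
structure IsBlochTest (L : ℝ) (k : Space) (F : Config N → ℂ) : Prop where
  /-- `F` is `C¹`. -/
  contDiff : ContDiff ℝ 1 F
  /-- Periodicity in every particle: `F(…, xᵢ + L eₐ, …) = F(…, xᵢ, …)`. -/
  periodic : ∀ (X : Config N) (i : Fin N) (a : Fin 3),
    F (X + Pi.single i (EuclideanSpace.single a L)) = F X
  /-- Bose symmetry. -/
  symm : ∀ (σ : Equiv.Perm (Fin N)) (X : Config N), F (X ∘ σ) = F X
  /-- The Bloch condition: total momentum `k`. -/
  bloch : HasTotalMomentum k F

/-- **The sectorial Poincaré constant** `ω_Ψ(k) = inf { E_Ψ(F) / ‖F‖²_Ψ : F Bloch-k, 0 < ‖F‖²_Ψ < ∞ }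
∈ [0, ∞]` of the weight `Ψ` at total momentum `k`: the bottom of the Rayleigh quotient of the
ground-state form over the Bloch-`k` test class. For `Ψ = Ψ₀` the ground state of the periodic
`N`-body Hamiltonian this is the infimum of the excitation spectrum in the sector,
`ε^{L,N}(k) = inf sp(H(k) - E^{L,N})`; Feynman's `F = ρ_k` gives the upper value `|k|²/S(k)`
(`sectorPoincareConstant_latticeVec_le`). `⊤` over an empty class (`k ∉ (2π/L)ℤ³`,
`sectorPoincareConstant_eq_top_of_forall_ne`). [cite: CorneanDerezinskiZin2009, §1.1 (1.6)] -/
def sectorPoincareConstant (L : ℝ) (Ψ : Config N → ℂ) (k : Space) : ℝ≥0∞ :=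
  ⨅ (F : Config N → ℂ) (_ : IsBlochTest L k F) (_ : weightedNormSq L Ψ F ≠ 0)
    (_ : weightedNormSq L Ψ F ≠ ⊤), groundStateDirichletForm L Ψ F / weightedNormSq L Ψ F

/-! ### Unfolding, scaling, constants -/

/-- `E_Ψ(F) = ∫_{cell} (∑ᵢ ∑ₐ ‖∂_{i,a}F(X)‖²) ‖Ψ(X)‖² dX`, all sums written out (`rfl`).
[cite: Davies1989, §4.2 Thm. 4.2.1 (proof), pp. 109–110] -/
theorem groundStateDirichletForm_eq (L : ℝ) (Ψ F : Config N → ℂ) :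
    groundStateDirichletForm L Ψ F = ∫⁻ X in cellN N L,
      (∑ i : Fin N, ∑ a : Fin 3,
        (‖fderiv ℝ F X (Pi.single i (EuclideanSpace.single a (1 : ℝ)))‖₊ : ℝ≥0∞) ^ 2) *
        (‖Ψ X‖₊ : ℝ≥0∞) ^ 2 :=
  rfl

/-- Unitarity of `U_Ψ F = FΨ`: `‖F‖²_Ψ = ∫_{cell} |F Ψ|²`. [cite: Davies1989, §4.2 Thm. 4.2.1 (proof), pp. 109–110] -/
theorem weightedNormSq_eq (L : ℝ) (Ψ F : Config N → ℂ) :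
    weightedNormSq L Ψ F = ∫⁻ X in cellN N L, (‖F X * Ψ X‖₊ : ℝ≥0∞) ^ 2 := by
  refine lintegral_congr fun X => ?_
  rw [nnnorm_mul, ENNReal.coe_mul, mul_pow]

/-- Constants have no kinetic density. [folklore] -/
@[simp]
theorem kineticDensity_const (c : ℂ) (X : Config N) : kineticDensity (fun _ : Config N => c) X = 0 := by
  simp [kineticDensity]

/-- Constants are `E_Ψ`-null: `E_Ψ(c) = 0` (so `ω_Ψ(0) = 0`, `sectorPoincareConstant_zero`). [folklore] -/
@[simp]
theorem groundStateDirichletForm_const (L : ℝ) (Ψ : Config N → ℂ) (c : ℂ) :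
    groundStateDirichletForm L Ψ (fun _ => c) = 0 := by
  simp [groundStateDirichletForm]

/-- `|∇(cF)|² = |c|² |∇F|²` pointwise, for a complex constant (no differentiability needed).
[folklore] -/
theorem kineticDensity_const_mul_complex (c : ℂ) (F : Config N → ℂ) (X : Config N) :
    kineticDensity (fun Y => c * F Y) X = (‖c‖₊ : ℝ≥0∞) ^ 2 * kineticDensity F X := by
  unfold kineticDensity
  rw [show (fun Y => c * F Y) = c • F from rfl, fderiv_const_smul_field, Finset.mul_sum]
  refine Finset.sum_congr rfl fun i _ => ?_
  rw [Finset.mul_sum]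
  refine Finset.sum_congr rfl fun a _ => ?_
  rw [Pi.smul_apply, smul_apply, smul_eq_mul, nnnorm_mul, ENNReal.coe_mul, mul_pow]

/-- `E_Ψ(cF) = |c|² E_Ψ(F)`. [folklore] -/
theorem groundStateDirichletForm_const_mul (L : ℝ) (Ψ : Config N → ℂ) (c : ℂ) (F : Config N → ℂ) :
    groundStateDirichletForm L Ψ (fun X => c * F X) =
      (‖c‖₊ : ℝ≥0∞) ^ 2 * groundStateDirichletForm L Ψ F := by
  unfold groundStateDirichletForm
  simp_rw [kineticDensity_const_mul_complex, mul_assoc]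
  exact lintegral_const_mul' _ _ (ENNReal.pow_ne_top ENNReal.coe_ne_top)

/-- `‖cF‖²_Ψ = |c|² ‖F‖²_Ψ`. [folklore] -/
theorem weightedNormSq_const_mul (L : ℝ) (Ψ : Config N → ℂ) (c : ℂ) (F : Config N → ℂ) :
    weightedNormSq L Ψ (fun X => c * F X) = (‖c‖₊ : ℝ≥0∞) ^ 2 * weightedNormSq L Ψ F := by
  unfold weightedNormSq
  simp_rw [nnnorm_mul, ENNReal.coe_mul, mul_pow, mul_assoc]
  exact lintegral_const_mul' _ _ (ENNReal.pow_ne_top ENNReal.coe_ne_top)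

/-- The Rayleigh quotient `E_Ψ(F)/‖F‖²_Ψ` is invariant under `F ↦ cF`, `c ≠ 0`. [folklore] -/
theorem groundStateDirichletForm_div_weightedNormSq_const_mul (L : ℝ) (Ψ : Config N → ℂ) {c : ℂ}
    (hc : c ≠ 0) (F : Config N → ℂ) :
    groundStateDirichletForm L Ψ (fun X => c * F X) / weightedNormSq L Ψ (fun X => c * F X) =
      groundStateDirichletForm L Ψ F / weightedNormSq L Ψ F := by
  rw [groundStateDirichletForm_const_mul, weightedNormSq_const_mul]
  refine ENNReal.mul_div_mul_left _ _ (pow_ne_zero 2 ?_) (ENNReal.pow_ne_top ENNReal.coe_ne_top)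
  rwa [ne_eq, ENNReal.coe_eq_zero, nnnorm_eq_zero]

/-- A constant weight `c` gives `|c|²` times the kinetic energy on the cell:
`E_c(F) = |c|² ∫_{cell} |∇F|²` (the free ground state is constant). [folklore] -/
theorem groundStateDirichletForm_const_weight (L : ℝ) (c : ℂ) (F : Config N → ℂ) :
    groundStateDirichletForm L (fun _ => c) F =
      (‖c‖₊ : ℝ≥0∞) ^ 2 * ∫⁻ X in cellN N L, kineticDensity F X := by
  unfold groundStateDirichletForm
  rw [lintegral_mul_const' _ _ (ENNReal.pow_ne_top ENNReal.coe_ne_top), mul_comm]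

/-- `E_Ψ(conj F) = E_Ψ(F)`. [folklore] -/
theorem groundStateDirichletForm_conj (L : ℝ) (Ψ F : Config N → ℂ) :
    groundStateDirichletForm L Ψ (fun X => conj (F X)) = groundStateDirichletForm L Ψ F := by
  unfold groundStateDirichletForm
  simp_rw [kineticDensity_conj]

/-- `‖conj F‖²_Ψ = ‖F‖²_Ψ`. [folklore] -/
theorem weightedNormSq_conj (L : ℝ) (Ψ F : Config N → ℂ) :
    weightedNormSq L Ψ (fun X => conj (F X)) = weightedNormSq L Ψ F := by
  unfold weightedNormSq
  simp_rw [RCLike.nnnorm_conj]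

/-- For a normalised periodic state the test function `1` has weighted norm `1`. [folklore] -/
theorem PeriodicTrialState.weightedNormSq_one (Ψ : PeriodicTrialState N L) :
    weightedNormSq L Ψ.ψ (fun _ => 1) = 1 := by
  simp [weightedNormSq, Ψ.norm_eq]

/-! ### Finiteness for continuous data; the real case -/

/-- For continuous `Ψ, F` the weighted norm on the (bounded) cell is finite, so the side condition
`‖F‖²_Ψ < ∞` in `sectorPoincareConstant` is automatic. [folklore] -/
theorem weightedNormSq_ne_top {Ψ F : Config N → ℂ} (hΨ : Continuous Ψ) (hF : Continuous F) :
    weightedNormSq L Ψ F ≠ ⊤ := by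
  have hint := integrableOn_cellN (f := fun X => ‖F X‖ ^ 2 * ‖Ψ X‖ ^ 2) (by fun_prop) L
  have h2 : (∫⁻ X in cellN N L, ‖‖F X‖ ^ 2 * ‖Ψ X‖ ^ 2‖ₑ) < ⊤ := hint.2
  refine ne_of_lt (lt_of_le_of_lt (le_of_eq (lintegral_congr fun X => ?_)) h2)
  rw [coe_nnnorm_sq_eq_ofReal, coe_nnnorm_sq_eq_ofReal, ← ENNReal.ofReal_mul (sq_nonneg _),
    Real.enorm_eq_ofReal (by positivity)]

/-- For continuous `Ψ` and `C¹` `F` the ground-state form on the cell is finite. [folklore] -/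
theorem groundStateDirichletForm_ne_top {Ψ F : Config N → ℂ} (hΨ : Continuous Ψ)
    (hF : ContDiff ℝ 1 F) : groundStateDirichletForm L Ψ F ≠ ⊤ := by
  set g : Config N → ℝ := fun X =>
    (∑ i : Fin N, ∑ a : Fin 3, ‖fderiv ℝ F X (Pi.single i (EuclideanSpace.single a (1 : ℝ)))‖ ^ 2) *
      ‖Ψ X‖ ^ 2 with hg
  have hgc : Continuous g := by
    have hd : Continuous (fderiv ℝ F) := hF.continuous_fderiv one_ne_zero
    fun_prop
  have hg0 : ∀ X, 0 ≤ g X := fun X =>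
    mul_nonneg (Finset.sum_nonneg fun i _ => Finset.sum_nonneg fun a _ => sq_nonneg _) (sq_nonneg _)
  have hint := integrableOn_cellN hgc L
  have h2 : (∫⁻ X in cellN N L, ‖g X‖ₑ) < ⊤ := hint.2
  refine ne_of_lt (lt_of_le_of_lt (le_of_eq (lintegral_congr fun X => ?_)) h2)
  rw [Real.enorm_eq_ofReal (hg0 X), hg]
  dsimp only
  rw [ENNReal.ofReal_mul (Finset.sum_nonneg fun i _ => Finset.sum_nonneg fun a _ => sq_nonneg _),
    ← coe_nnnorm_sq_eq_ofReal]
  congr 1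
  unfold kineticDensity
  rw [ENNReal.ofReal_sum_of_nonneg fun i _ => Finset.sum_nonneg fun a _ => sq_nonneg _]
  refine Finset.sum_congr rfl fun i _ => ?_
  rw [ENNReal.ofReal_sum_of_nonneg fun a _ => sq_nonneg _]
  exact Finset.sum_congr rfl fun a _ => coe_nnnorm_sq_eq_ofReal _

/-- **Agreement with the real bilinear form.** For a real continuous weight `w` and a real `C¹`
test function `φ`, `E_w(φ) = ENNReal.ofReal (𝓔_w(φ, φ))` with `𝓔_w = dirichletFormW` of
`WeightedCorrector.lean` (`∫_{cell} ∇φ·∇φ w²`). [folklore] -/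
theorem groundStateDirichletForm_ofReal {w φ : Config N → ℝ} (hw : Continuous w)
    (hφ : ContDiff ℝ 1 φ) :
    groundStateDirichletForm L (fun X => (w X : ℂ)) (fun X => (φ X : ℂ)) =
      ENNReal.ofReal (dirichletFormW L w φ φ) := by
  have hd : Differentiable ℝ φ := hφ.differentiable one_ne_zero
  have hpt : ∀ X, kineticDensity (fun X => (φ X : ℂ)) X * ((‖(w X : ℂ)‖₊ : ℝ≥0∞)) ^ 2 =
      ENNReal.ofReal (gradDot φ φ X * w X ^ 2) := by
    intro X
    have hder : fderiv ℝ (fun X => (φ X : ℂ)) X = Complex.ofRealCLM.comp (fderiv ℝ φ X) :=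
      (Complex.ofRealCLM.hasFDerivAt.comp X (hd X).hasFDerivAt).fderiv
    rw [ENNReal.ofReal_mul (gradDot_self_nonneg φ X), coe_nnnorm_sq_eq_ofReal, Complex.norm_real,
      Real.norm_eq_abs, sq_abs]
    congr 1
    unfold kineticDensity gradDot pderiv
    rw [ENNReal.ofReal_sum_of_nonneg fun i _ => Finset.sum_nonneg fun a _ => mul_self_nonneg _]
    refine Finset.sum_congr rfl fun i _ => ?_
    rw [ENNReal.ofReal_sum_of_nonneg fun a _ => mul_self_nonneg _]
    refine Finset.sum_congr rfl fun a _ => ?_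
    rw [coe_nnnorm_sq_eq_ofReal, hder, ContinuousLinearMap.comp_apply, Complex.ofRealCLM_apply,
      Complex.norm_real, Real.norm_eq_abs, sq_abs, sq]
  unfold groundStateDirichletForm dirichletFormW
  simp_rw [hpt]
  exact (ofReal_integral_eq_lintegral_ofReal (integrableOn_gradDot_mul_sq hw hφ hφ L)
    (Eventually.of_forall fun X => mul_nonneg (gradDot_self_nonneg φ X) (sq_nonneg _))).symm

/-! ### The Bloch test class -/

namespace IsBlochTest

variable {k k₁ k₂ : Space} {F G : Config N → ℂ}

/-- A Bloch test function is continuous. [folklore] -/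
theorem continuous (hF : IsBlochTest L k F) : Continuous F :=
  hF.contDiff.continuous

/-- A Bloch test function is differentiable. [folklore] -/
theorem differentiable (hF : IsBlochTest L k F) : Differentiable ℝ F :=
  hF.contDiff.differentiable one_ne_zero

/-- Constants are Bloch test functions of momentum `0`. [folklore] -/
theorem const (L : ℝ) (c : ℂ) : IsBlochTest L (0 : Space) (fun _ : Config N => c) where
  contDiff := contDiff_const
  periodic _ _ _ := rfl
  symm _ _ := rfl
  bloch := hasTotalMomentum_zero_iff.2 fun _ _ => rfl

/-- Momenta add under products of Bloch test functions. [folklore] -/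
theorem mul (hF : IsBlochTest L k₁ F) (hG : IsBlochTest L k₂ G) :
    IsBlochTest L (k₁ + k₂) (fun X => F X * G X) where
  contDiff := hF.contDiff.mul hG.contDiff
  periodic X i a := by simp only [hF.periodic X i a, hG.periodic X i a]
  symm σ X := by simp only [hF.symm σ X, hG.symm σ X]
  bloch := hF.bloch.mul hG.bloch

/-- Scalar multiples stay in the class. [folklore] -/
theorem const_mul (hF : IsBlochTest L k F) (c : ℂ) : IsBlochTest L k (fun X => c * F X) := by
  simpa using (IsBlochTest.const L c).mul hF

/-- Sums (same `k`) stay in the class. [folklore] -/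
theorem add (hF : IsBlochTest L k F) (hG : IsBlochTest L k G) :
    IsBlochTest L k (fun X => F X + G X) where
  contDiff := hF.contDiff.add hG.contDiff
  periodic X i a := by simp only [hF.periodic X i a, hG.periodic X i a]
  symm σ X := by simp only [hF.symm σ X, hG.symm σ X]
  bloch := hF.bloch.add hG.bloch

/-- Translating *every* particle by the lattice generator `L eₐ` does not change a Bloch test
function (per-particle periodicity, one particle at a time). [folklore] -/
theorem apply_add_single (hF : IsBlochTest L k F) (X : Config N) (a : Fin 3) :
    F (fun i => X i + EuclideanSpace.single a L) = F X := by
  have key : ∀ S : Finset (Fin N),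
      F (X + ∑ i ∈ S, Pi.single i (EuclideanSpace.single a L)) = F X := by
    intro S
    induction S using Finset.induction_on with
    | empty => simp
    | insert j S hj ih =>
      rw [Finset.sum_insert hj, add_comm (Pi.single j _), ← add_assoc, hF.periodic, ih]
  have h := key Finset.univ
  rw [Finset.univ_sum_single (fun _ : Fin N => (EuclideanSpace.single a L : Space))] at h
  exact h

/-- **The class is empty off the dual lattice**: a Bloch test function that does not vanish
identically has `k ∈ (2π/L)ℤ³` (translation of all particles by `L eₐ` is trivial and multiplies
by `e^{i kₐ L}`). [cite: CorneanDerezinskiZin2009, §1.1 (joint spectrum of `P^{L,n}`)] -/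
theorem exists_eq_latticeVec (hL : L ≠ 0) (hF : IsBlochTest L k F) {X : Config N} (hX : F X ≠ 0) :
    ∃ n : Fin 3 → ℤ, k = latticeVec (2 * Real.pi / L) n := by
  have hcoord : ∀ a : Fin 3, ∃ n : ℤ, k a * L = n * (2 * Real.pi) := by
    intro a
    have h1 := hF.bloch (EuclideanSpace.single a L) X
    rw [hF.apply_add_single] at h1
    have hsum : (∑ j, k j * (EuclideanSpace.single a L : Space) j) = k a * L := by
      simp
    rw [hsum] at h1
    have h2 : Complex.exp (Complex.I * ↑(k a * L)) = 1 :=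
      mul_right_cancel₀ hX (h1.symm.trans (one_mul _).symm)
    obtain ⟨n, hn⟩ := Complex.exp_eq_one_iff.mp h2
    refine ⟨n, ?_⟩
    have hn' : ((k a * L : ℝ) : ℂ) = ((n * (2 * Real.pi) : ℝ) : ℂ) := by
      apply mul_left_cancel₀ Complex.I_ne_zero
      rw [hn]; push_cast; ring
    exact_mod_cast hn'
  choose n hn using hcoord
  refine ⟨n, ?_⟩
  ext a
  simp only [latticeVec, PiLp.toLp_apply]
  have := hn a
  field_simp
  linarith

end IsBlochTest

/-- Complex conjugation maps the Bloch class at `k` onto the class at `-k`. [folklore] -/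
theorem IsBlochTest.conj {k : Space} {F : Config N → ℂ} (hF : IsBlochTest L k F) :
    IsBlochTest L (-k) (fun X => conj (F X)) where
  contDiff := Complex.conjCLE.contDiff.comp hF.contDiff
  periodic X i a := by simp only [hF.periodic X i a]
  symm σ X := by simp only [hF.symm σ X]
  bloch := hF.bloch.conj

/-- A test function of non-zero weighted norm does not vanish identically. [folklore] -/
theorem exists_ne_zero_of_weightedNormSq_ne_zero {Ψ F : Config N → ℂ}
    (h : weightedNormSq L Ψ F ≠ 0) : ∃ X, F X ≠ 0 := by
  by_contra hX
  push Not at hX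
  apply h
  simp [weightedNormSq, hX]

/-- **Feynman's density waves are Bloch test functions**: `ρ_k = ∑ⱼ e^{ik·xⱼ}`
(`planeWaveSum L n`, `k = 2πn/L`) is `C¹`, periodic, symmetric, of total momentum `k`.
[cite: Stringari1995, §3 (37)] -/
theorem isBlochTest_planeWaveSum (hL : L ≠ 0) (n : Fin 3 → ℤ) :
    IsBlochTest L (latticeVec (2 * Real.pi / L) n) (planeWaveSum (M := N) L n) where
  contDiff := contDiff_planeWaveSum L n
  periodic X i a := planeWaveSum_periodic hL n X i a
  symm σ X := planeWaveSum_symm L n σ X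
  bloch := hasTotalMomentum_planeWaveSum L n

/-- `planeWaveSum` (built on `cellWave`) is the density-wave observable `densityWave` of
`BoseGasStructureFactor.lean` (built on an explicit exponential), pointwise. [folklore] -/
theorem planeWaveSum_eq_densityWave (L : ℝ) (n : Fin 3 → ℤ) (X : Config N) :
    planeWaveSum L n X = densityWave N L n X := by
  unfold planeWaveSum densityWave
  refine Finset.sum_congr rfl fun j _ => ?_
  rw [cellWave_apply]
  congr 1
  push_cast
  ring

/-! ### The f-sum rule numerator `E_Ψ(ρ_k) = N |k|² ∫|Ψ|²` -/

/-- `∂_{i,a} ρ_k(X) = i kₐ e^{ik·xᵢ}` for `ρ_k = ∑ⱼ e^{ik·xⱼ}`, `k = 2πn/L`. [folklore] -/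
theorem fderiv_planeWaveSum_apply_single (L : ℝ) (n : Fin 3 → ℤ) (X : Config N) (i : Fin N)
    (a : Fin 3) :
    fderiv ℝ (planeWaveSum (M := N) L n) X (Pi.single i (EuclideanSpace.single a 1)) =
      (2 * Real.pi * Complex.I * (n a) / L) * cellWave L n (X i) := by
  have hg : ∀ j : Fin N, HasFDerivAt (cellWave L n) (fderiv ℝ (cellWave L n) (X j)) (X j) :=
    fun j => (((contDiff_cellWave L n).differentiable (by simp)) (X j)).hasFDerivAt
  have hd : ∀ j : Fin N, HasFDerivAt (fun Y : Config N => cellWave L n (Y j))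
      ((fderiv ℝ (cellWave L n) (X j)).comp (ContinuousLinearMap.proj j)) X := by
    intro j
    have h := (hg j).comp X (hasFDerivAt_apply (𝕜 := ℝ) j X)
    simpa only [Function.comp_def] using h
  have hs : HasFDerivAt (planeWaveSum (M := N) L n)
      (∑ j, (fderiv ℝ (cellWave L n) (X j)).comp (ContinuousLinearMap.proj j)) X :=
    HasFDerivAt.fun_sum fun j _ => hd j
  rw [hs.fderiv, sum_apply]
  simp only [ContinuousLinearMap.comp_apply, ContinuousLinearMap.proj_apply, Pi.single_apply]
  rw [Finset.sum_eq_single i (fun j _ hj => by rw [if_neg hj, map_zero])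
    (fun h => absurd (Finset.mem_univ i) h), if_pos rfl, fderiv_cellWave_apply_single]

/-- **`|∇ρ_k|² = N|k|²` pointwise**: `∑ᵢ ∑ₐ |∂_{i,a} ρ_k|² = ∑ᵢ ∑ₐ kₐ² = N |k|²` (`k = 2πn/L`).
[cite: Stringari1995, §3 (40)] -/
theorem kineticDensity_planeWaveSum (L : ℝ) (n : Fin 3 → ℤ) (X : Config N) :
    kineticDensity (planeWaveSum (M := N) L n) X =
      N * (‖latticeVec (2 * Real.pi / L) n‖₊ : ℝ≥0∞) ^ 2 := by
  have hterm : ∀ (i : Fin N) (a : Fin 3),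
      ((‖fderiv ℝ (planeWaveSum (M := N) L n) X
        (Pi.single i (EuclideanSpace.single a 1))‖₊ : ℝ≥0∞)) ^ 2 =
        ENNReal.ofReal ((latticeVec (2 * Real.pi / L) n) a ^ 2) := by
    intro i a
    rw [coe_nnnorm_sq_eq_ofReal, fderiv_planeWaveSum_apply_single, norm_mul, norm_cellWave,
      mul_one]
    congr 1
    rw [show (2 * Real.pi * Complex.I * (n a) / L : ℂ) = ((2 * Real.pi * (n a) / L : ℝ) : ℂ) *
      Complex.I by push_cast; ring]
    rw [norm_mul, Complex.norm_I, mul_one, Complex.norm_real, Real.norm_eq_abs, sq_abs]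
    simp only [latticeVec, PiLp.toLp_apply]
    ring
  unfold kineticDensity
  simp_rw [hterm]
  rw [Finset.sum_const, Finset.card_univ, Fintype.card_fin, nsmul_eq_mul]
  congr 1
  rw [coe_nnnorm_sq_eq_ofReal, EuclideanSpace.real_norm_sq_eq,
    ENNReal.ofReal_sum_of_nonneg fun a _ => sq_nonneg _]

/-- **The f-sum rule numerator**: `E_Ψ(ρ_k) = N|k|² ∫_{cell} |Ψ|²` for Feynman's `F = ρ_k`,
`k = 2πn/L` (`= N|k|²` for a normalised `Ψ`; this is `½⟨[ρ_k†, [H, ρ_k]]⟩ = N k²/2m` with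
`2m = 1`). [cite: Stringari1995, §3 (40)] -/
theorem groundStateDirichletForm_planeWaveSum (L : ℝ) (Ψ : Config N → ℂ) (n : Fin 3 → ℤ) :
    groundStateDirichletForm L Ψ (planeWaveSum L n) =
      N * (‖latticeVec (2 * Real.pi / L) n‖₊ : ℝ≥0∞) ^ 2 *
        ∫⁻ X in cellN N L, (‖Ψ X‖₊ : ℝ≥0∞) ^ 2 := by
  unfold groundStateDirichletForm
  simp_rw [kineticDensity_planeWaveSum]
  exact lintegral_const_mul' _ _
    (ENNReal.mul_ne_top (ENNReal.natCast_ne_top N) (ENNReal.pow_ne_top ENNReal.coe_ne_top))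

/-- `‖ρ_k‖²_Ψ ≤ N² ∫_{cell} |Ψ|²` (`|ρ_k| ≤ N`). [folklore] -/
theorem weightedNormSq_planeWaveSum_le (L : ℝ) (Ψ : Config N → ℂ) (n : Fin 3 → ℤ) :
    weightedNormSq L Ψ (planeWaveSum L n) ≤
      (N : ℝ≥0∞) ^ 2 * ∫⁻ X in cellN N L, (‖Ψ X‖₊ : ℝ≥0∞) ^ 2 := by
  unfold weightedNormSq
  rw [← lintegral_const_mul' _ _ (ENNReal.pow_ne_top (ENNReal.natCast_ne_top N))]
  refine lintegral_mono fun X => ?_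
  gcongr
  rw [← ENNReal.coe_natCast, ENNReal.coe_le_coe, ← NNReal.coe_le_coe, coe_nnnorm, NNReal.coe_natCast]
  exact norm_planeWaveSum_le L n X

/-! ### The sectorial Poincaré constant -/

section Poincare

variable {Ψ F : Config N → ℂ} {k : Space}

/-- **Variational principle**: every Bloch-`k` test function with `0 < ‖F‖²_Ψ < ∞` bounds
`ω_Ψ(k)` by its Rayleigh quotient. [cite: Stringari1995, §3 (40)] -/
theorem sectorPoincareConstant_le (hF : IsBlochTest L k F) (h0 : weightedNormSq L Ψ F ≠ 0)
    (ht : weightedNormSq L Ψ F ≠ ⊤) :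
    sectorPoincareConstant L Ψ k ≤ groundStateDirichletForm L Ψ F / weightedNormSq L Ψ F :=
  (iInf_le _ F).trans <| (iInf_le _ hF).trans <| (iInf_le _ h0).trans (iInf_le _ ht)

/-- **Lower bounds on `ω_Ψ(k)` are exactly sectorial Poincaré inequalities**:
`λ ≤ ω_Ψ(k) ⟺ λ ‖F‖²_Ψ ≤ E_Ψ(F)` for every Bloch-`k` test function with `0 < ‖F‖²_Ψ < ∞`.
[folklore] -/
theorem le_sectorPoincareConstant_iff {a : ℝ≥0∞} :
    a ≤ sectorPoincareConstant L Ψ k ↔ ∀ F : Config N → ℂ, IsBlochTest L k F →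
      weightedNormSq L Ψ F ≠ 0 → weightedNormSq L Ψ F ≠ ⊤ →
        a * weightedNormSq L Ψ F ≤ groundStateDirichletForm L Ψ F := by
  simp only [sectorPoincareConstant, le_iInf_iff]
  refine forall_congr' fun F => forall_congr' fun _ => forall_congr' fun h0 =>
    forall_congr' fun ht => ?_
  exact ENNReal.le_div_iff_mul_le (Or.inl h0) (Or.inl ht)

/-- **The sectorial Poincaré inequality** `ω_Ψ(k) ‖F‖²_Ψ ≤ E_Ψ(F)` on the Bloch-`k` class
(`‖F‖²_Ψ < ∞`, automatic for continuous `Ψ`). [folklore] -/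
theorem sectorPoincareConstant_mul_weightedNormSq_le (hF : IsBlochTest L k F)
    (ht : weightedNormSq L Ψ F ≠ ⊤) :
    sectorPoincareConstant L Ψ k * weightedNormSq L Ψ F ≤ groundStateDirichletForm L Ψ F := by
  rcases eq_or_ne (weightedNormSq L Ψ F) 0 with h0 | h0
  · simp [h0]
  · exact le_sectorPoincareConstant_iff.1 le_rfl F hF h0 ht

/-- **Centre-of-mass lower bound** `|k|²/N ≤ ω_Ψ(k)` for *every* weight: a Bloch-`k` function
has `(|k|²/N)|F|² ≤ |∇F|²` pointwise (`∑ⱼ ∂_{j,a}F = i kₐ F` and Cauchy–Schwarz), i.e. the sector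
carries at least the kinetic energy `P²/(2mN)` of the centre of mass.
[cite: CorneanDerezinskiZin2009, §2.2 (2.3)] -/
theorem ofReal_norm_sq_div_le_sectorPoincareConstant (L : ℝ) (Ψ : Config N → ℂ) (k : Space) :
    ENNReal.ofReal (‖k‖ ^ 2 / N) ≤ sectorPoincareConstant L Ψ k := by
  refine le_sectorPoincareConstant_iff.2 fun F hF _ _ => ?_
  unfold weightedNormSq groundStateDirichletForm
  rw [← lintegral_const_mul' _ _ ENNReal.ofReal_ne_top]
  refine lintegral_mono fun X => ?_
  rw [← mul_assoc]
  gcongr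
  exact hF.bloch.norm_sq_mul_le_kineticDensity hF.differentiable X

/-- **`ω_Ψ(0) = 0`**: the constant test function `1` is Bloch-`0` and `E_Ψ`-null (for a weight
with `0 < ∫_{cell}|Ψ|² < ∞`). [folklore] -/
theorem sectorPoincareConstant_zero (h0 : ∫⁻ X in cellN N L, (‖Ψ X‖₊ : ℝ≥0∞) ^ 2 ≠ 0)
    (ht : ∫⁻ X in cellN N L, (‖Ψ X‖₊ : ℝ≥0∞) ^ 2 ≠ ⊤) : sectorPoincareConstant L Ψ 0 = 0 := by
  have h1 : weightedNormSq L Ψ (fun _ => (1 : ℂ)) = ∫⁻ X in cellN N L, (‖Ψ X‖₊ : ℝ≥0∞) ^ 2 := by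
    simp [weightedNormSq]
  refine le_antisymm ?_ bot_le
  refine (sectorPoincareConstant_le (IsBlochTest.const L 1) (by rwa [h1]) (by rwa [h1])).trans ?_
  rw [groundStateDirichletForm_const, ENNReal.zero_div]

/-- `ω_Ψ(0) = 0` for a normalised periodic state. [folklore] -/
theorem PeriodicTrialState.sectorPoincareConstant_zero (Ψ : PeriodicTrialState N L) :
    sectorPoincareConstant L Ψ.ψ 0 = 0 :=
  BoseGas.sectorPoincareConstant_zero (by rw [Ψ.norm_eq]; exact one_ne_zero)
    (by rw [Ψ.norm_eq]; exact ENNReal.one_ne_top)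

/-- **Reflection symmetry** `ω_Ψ(-k) = ω_Ψ(k)` (complex conjugation maps the class at `k` onto the
class at `-k` preserving `E_Ψ` and `‖·‖_Ψ`). [folklore] -/
theorem sectorPoincareConstant_neg (L : ℝ) (Ψ : Config N → ℂ) (k : Space) :
    sectorPoincareConstant L Ψ (-k) = sectorPoincareConstant L Ψ k := by
  have key : ∀ k : Space, sectorPoincareConstant L Ψ (-k) ≤ sectorPoincareConstant L Ψ k := by
    intro k
    refine le_iInf fun F => le_iInf fun hF => le_iInf fun h0 => le_iInf fun ht => ?_
    rw [← groundStateDirichletForm_conj, ← weightedNormSq_conj]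
    exact sectorPoincareConstant_le hF.conj (by rwa [weightedNormSq_conj])
      (by rwa [weightedNormSq_conj])
  refine le_antisymm (key k) ?_
  simpa using key (-k)

/-- **Empty classes**: off the dual lattice `(2π/L)ℤ³` no Bloch-`k` test function has positive
weighted norm, and `ω_Ψ(k) = ⊤`. [cite: CorneanDerezinskiZin2009, §1.1 (joint spectrum of `P^{L,n}`)] -/
theorem sectorPoincareConstant_eq_top_of_forall_ne (hL : L ≠ 0) (Ψ : Config N → ℂ)
    (hk : ∀ n : Fin 3 → ℤ, k ≠ latticeVec (2 * Real.pi / L) n) :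
    sectorPoincareConstant L Ψ k = ⊤ := by
  refine iInf_eq_top.2 fun F => iInf_eq_top.2 fun hF => iInf_eq_top.2 fun h0 => ?_
  obtain ⟨X, hX⟩ := exists_ne_zero_of_weightedNormSq_ne_zero h0
  obtain ⟨n, hn⟩ := hF.exists_eq_latticeVec hL hX
  exact absurd hn (hk n)

/-- **Feynman's upper bound** `ω_Ψ(k) ≤ E_Ψ(ρ_k)/‖ρ_k‖²_Ψ = N|k|² ∫_{cell}|Ψ|² / ‖ρ_k‖²_Ψ`
(`= |k|²/S(k)` for a normalised `Ψ`, `N S(k) = ‖ρ_k‖²_Ψ` uncentred), `k = 2πn/L`, whenever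
`0 < ‖ρ_k‖²_Ψ < ∞`. [cite: Stringari1995, §3 (40)] -/
theorem sectorPoincareConstant_latticeVec_le (hL : L ≠ 0) (Ψ : Config N → ℂ) (n : Fin 3 → ℤ)
    (h0 : weightedNormSq L Ψ (planeWaveSum L n) ≠ 0)
    (ht : weightedNormSq L Ψ (planeWaveSum L n) ≠ ⊤) :
    sectorPoincareConstant L Ψ (latticeVec (2 * Real.pi / L) n) ≤
      N * (‖latticeVec (2 * Real.pi / L) n‖₊ : ℝ≥0∞) ^ 2 *
        (∫⁻ X in cellN N L, (‖Ψ X‖₊ : ℝ≥0∞) ^ 2) / weightedNormSq L Ψ (planeWaveSum L n) := by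
  rw [← groundStateDirichletForm_planeWaveSum]
  exact sectorPoincareConstant_le (isBlochTest_planeWaveSum hL n) h0 ht

/-- Feynman's bound for a normalised periodic state: `ω_Ψ(k) ≤ N|k|² / ‖ρ_k‖²_Ψ` (the finiteness
of `‖ρ_k‖²_Ψ ≤ N²` is automatic). [cite: Stringari1995, §3 (40)] -/
theorem PeriodicTrialState.sectorPoincareConstant_latticeVec_le (hL : 0 < L)
    (Ψ : PeriodicTrialState N L) (n : Fin 3 → ℤ)
    (h0 : weightedNormSq L Ψ.ψ (planeWaveSum L n) ≠ 0) :
    sectorPoincareConstant L Ψ.ψ (latticeVec (2 * Real.pi / L) n) ≤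
      N * (‖latticeVec (2 * Real.pi / L) n‖₊ : ℝ≥0∞) ^ 2 / weightedNormSq L Ψ.ψ (planeWaveSum L n) := by
  have ht : weightedNormSq L Ψ.ψ (planeWaveSum L n) ≠ ⊤ :=
    ne_top_of_le_ne_top (by rw [Ψ.norm_eq, mul_one]; exact ENNReal.pow_ne_top (ENNReal.natCast_ne_top N))
      (weightedNormSq_planeWaveSum_le L Ψ.ψ n)
  have h := BoseGas.sectorPoincareConstant_latticeVec_le hL.ne' Ψ.ψ n h0 ht
  rwa [Ψ.norm_eq, mul_one] at h

/-- **The free particle, exactly.** For one particle and the constant weight (the free ground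
state on the torus of side `L > 0`), `ω(k) = |k|²` on the dual lattice `k = 2πn/L`: Feynman's
`F = e^{ik·x}` gives `≤`, the centre-of-mass inequality gives `≥` (non-vacuity of all four
definitions). [folklore] -/
theorem sectorPoincareConstant_const_one (hL : 0 < L) (n : Fin 3 → ℤ) :
    sectorPoincareConstant L (PeriodicTrialState.const hL).ψ (latticeVec (2 * Real.pi / L) n) =
      (‖latticeVec (2 * Real.pi / L) n‖₊ : ℝ≥0∞) ^ 2 := by
  set Ψ := PeriodicTrialState.const hL
  have hw : weightedNormSq L Ψ.ψ (planeWaveSum L n) = 1 := by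
    rw [← Ψ.norm_eq]
    refine lintegral_congr fun X => ?_
    have h1 : ‖planeWaveSum (M := 1) L n X‖₊ = 1 := by
      rw [← NNReal.coe_inj, coe_nnnorm]
      simp [planeWaveSum, norm_cellWave]
    rw [h1, ENNReal.coe_one, one_pow, one_mul]
  refine le_antisymm ?_ ?_
  · have h := Ψ.sectorPoincareConstant_latticeVec_le hL n (by rw [hw]; exact one_ne_zero)
    rwa [hw, div_one, Nat.cast_one, one_mul] at h
  · have h := ofReal_norm_sq_div_le_sectorPoincareConstant L Ψ.ψ (latticeVec (2 * Real.pi / L) n)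
    rwa [Nat.cast_one, div_one, ← coe_nnnorm_sq_eq_ofReal] at h

end Poincare

/-! ### The ground-state transform at the level of admissible states -/

/-- **The ground-state transform** `U_Ψ F = FΨ / ‖FΨ‖` of a Bloch test function `F` with
`0 < ‖F‖²_Ψ < ∞` by a periodic admissible state `Ψ`: again an admissible periodic state
(Davies' unitary `U_φ f = φ f`, normalised). [cite: Davies1989, §4.2 Thm. 4.2.1 (proof), pp. 109–110] -/
def PeriodicTrialState.gsTransform (Ψ : PeriodicTrialState N L) {k : Space} {F : Config N → ℂ}
    (hF : IsBlochTest L k F) (h0 : weightedNormSq L Ψ.ψ F ≠ 0) (ht : weightedNormSq L Ψ.ψ F ≠ ⊤) :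
    PeriodicTrialState N L :=
  PeriodicTrialState.ofFun (fun X => F X * Ψ.ψ X) (hF.contDiff.mul Ψ.contDiff)
    (fun X i a => by simp only [hF.periodic X i a, Ψ.periodic X i a])
    (fun σ X => by simp only [hF.symm σ X, Ψ.symm σ X])
    (by rwa [← weightedNormSq_eq]) (by rwa [← weightedNormSq_eq])

/-- The transformed state is `FΨ` up to the normalising constant. [folklore] -/
theorem PeriodicTrialState.gsTransform_apply (Ψ : PeriodicTrialState N L) {k : Space}
    {F : Config N → ℂ} (hF : IsBlochTest L k F) (h0 : weightedNormSq L Ψ.ψ F ≠ 0)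
    (ht : weightedNormSq L Ψ.ψ F ≠ ⊤) (X : Config N) :
    (Ψ.gsTransform hF h0 ht).ψ X =
      ((Real.sqrt (∫⁻ X in cellN N L, ((‖F X * Ψ.ψ X‖₊ : ℝ≥0∞)) ^ 2).toReal)⁻¹ : ℂ) *
        (F X * Ψ.ψ X) :=
  rfl

/-- **`U_Ψ` maps the Bloch-`k` class into the sector `k`** when `Ψ` is translation invariant
(total momentum `0`): momenta add. [cite: CorneanDerezinskiZin2009, §1.1 (1.6)] -/
theorem PeriodicTrialState.hasTotalMomentum_gsTransform (Ψ : PeriodicTrialState N L)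
    (hΨ : HasTotalMomentum 0 Ψ.ψ) {k : Space} {F : Config N → ℂ} (hF : IsBlochTest L k F)
    (h0 : weightedNormSq L Ψ.ψ F ≠ 0) (ht : weightedNormSq L Ψ.ψ F ≠ ⊤) :
    HasTotalMomentum k (Ψ.gsTransform hF h0 ht).ψ := by
  have h := hF.bloch.mul hΨ
  rw [add_zero] at h
  exact h.ofFun _ _ _ _ _

/-- Consequently the sector energy is bounded by the energy of every transformed state:
`inf sp H(k) ≤ ⟨U_Ψ F, H U_Ψ F⟩`. [cite: CorneanDerezinskiZin2009, §1.1 (1.6)] -/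
theorem PeriodicTrialState.momentumSectorEnergy_le_gsTransform (v : ℝ → ℝ≥0∞)
    (Ψ : PeriodicTrialState N L) (hΨ : HasTotalMomentum 0 Ψ.ψ) {k : Space} {F : Config N → ℂ}
    (hF : IsBlochTest L k F) (h0 : weightedNormSq L Ψ.ψ F ≠ 0)
    (ht : weightedNormSq L Ψ.ψ F ≠ ⊤) :
    momentumSectorEnergy v N L k ≤ periodicEnergy v (Ψ.gsTransform hF h0 ht) :=
  momentumSectorEnergy_le v _ (Ψ.hasTotalMomentum_gsTransform hΨ hF h0 ht)

end Literature.MathematicalPhysics.QuantumManyBody.BoseGas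

end
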